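import Summits.Ventures.PercRepro.RLSCoreFlatsSmall
import Summits.Ventures.PercRepro.RLSRuleCoreSix

/-!
# The flats of the core are small, sharpened by the rank-`3` value `f(3) = 6` (night-3, gen 4)

From `exists_cover_erase_of_core` (`RLSCoreFlatsSmall`) and `card_le_six_of_core` (`RLSRuleCoreSix`):
`f(q) ≤ 2 f(q − 1) + 1` with `f(3) = 6` gives **`card_add_one_le_seven_mul_two_pow_of_core`**: for a rank-`q` flat
with `q ≥ 3`, `|F| + 1 ≤ 7 · 2^(q − 3)` — rank `4`: `≤ 13` (`card_le_thirteen_of_core`, engine 4828's figure), rank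
`5`: `≤ 27`.
Imports `RLSCoreFlatsSmall`, `RLSRuleCoreSix`.  Axioms: standard.
-/

open scoped Matroid

namespace PercRepro

namespace NightThree

open Finset ThmH PerFlat

variable {α : Type*} [DecidableEq α] {M : Matroid α} [M.Finite]

/-- A flat of rank `≤ 3` of the core has at most `6` points. -/
theorem card_le_six_of_rank_le_three_of_core {p : ℕ} (hc : Core M p) {F : Finset α} {r : ℕ} (hr : r ≤ 3)
    (hF : F ∈ flatsQ M r) : F.card ≤ 6 := by
  rcases (show r = 3 ∨ r ≤ 2 by omega) with h3 | h2
  · subst h3; exact card_le_six_of_core hc hF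
  · have := card_add_one_le_two_pow_of_core hc r F hF
    have : 2 ^ r ≤ 2 ^ 2 := Nat.pow_le_pow_right (by norm_num) h2
    omega

/-- **`|F| + 1 ≤ 7 · 2^(q − 3)`** for every rank-`q` flat of the core, `q ≥ 3` (`f(3) = 6` and the recursion
`f(q) ≤ 2 f(q − 1) + 1`). -/
theorem card_add_one_le_seven_mul_two_pow_of_core {p : ℕ} (hc : Core M p) :
    ∀ (q : ℕ), 3 ≤ q → ∀ (F : Finset α), F ∈ flatsQ M q → F.card + 1 ≤ 7 * 2 ^ (q - 3) := by
  intro q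
  induction q using Nat.strong_induction_on with
  | _ q ih =>
    intro hq F hF
    rcases (show q = 3 ∨ 4 ≤ q by omega) with h3 | h4
    · subst h3
      have := card_le_six_of_core hc hF
      norm_num; omega
    rcases F.eq_empty_or_nonempty with hemp | ⟨e, he⟩
    · rw [hemp, Finset.card_empty]; exact Nat.one_le_iff_ne_zero.2 (by positivity)
    obtain ⟨F₁, F₂, r₁, r₂, hr₁, hr₂, hF₁, hF₂, _, _, hcov⟩ := exists_cover_erase_of_core hc hF he
    -- each part: rank `≤ q − 1`; if `≥ 3` use the induction, else `≤ 6 ≤ 7 · 2^(q − 4)`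
    have hpart : ∀ (r : ℕ) (G : Finset α), r < q → G ∈ flatsQ M r → G.card + 1 ≤ 7 * 2 ^ (q - 4) := by
      intro r G hr hG
      rcases Nat.lt_or_ge r 3 with hlt | hge
      · have := card_le_six_of_rank_le_three_of_core hc (by omega) hG
        have : 1 ≤ 2 ^ (q - 4) := Nat.one_le_two_pow
        omega
      · have := ih r hr hge G hG
        have : 2 ^ (r - 3) ≤ 2 ^ (q - 4) := Nat.pow_le_pow_right (by norm_num) (by omega)
        omega
    have h1 := hpart r₁ F₁ hr₁ hF₁
    have h2 := hpart r₂ F₂ hr₂ hF₂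
    have hq : 7 * 2 ^ (q - 3) = 2 * (7 * 2 ^ (q - 4)) := by
      obtain ⟨q', rfl⟩ : ∃ q', q = q' + 4 := ⟨q - 4, by omega⟩
      rw [show q' + 4 - 3 = (q' + 4 - 4) + 1 by omega, pow_succ]; ring
    have hcard : F.card = (F.erase e).card + 1 := by rw [Finset.card_erase_add_one he]
    have hle : (F.erase e).card ≤ F₁.card + F₂.card :=
      (Finset.card_le_card hcov).trans (Finset.card_union_le _ _)
    omega

/-- Rank `4`: every rank-`4` flat of the core has at most `13` points. -/
theorem card_le_thirteen_of_core {p : ℕ} (hc : Core M p) {F : Finset α} (hF : F ∈ flatsQ M 4) : F.card ≤ 13 := by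
  have := card_add_one_le_seven_mul_two_pow_of_core hc 4 (by norm_num) F hF
  norm_num at this; omega

/-- Rank `5`: every rank-`5` flat of the core has at most `27` points. -/
theorem card_le_twentyseven_of_core {p : ℕ} (hc : Core M p) {F : Finset α} (hF : F ∈ flatsQ M 5) :
    F.card ≤ 27 := by
  have := card_add_one_le_seven_mul_two_pow_of_core hc 5 (by norm_num) F hF
  norm_num at this; omega

end NightThree

end PercRepro
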